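import Literature.AlgebraicGeometry.HodgeTheory.WeilClassesProductsOfFactors
import Literature.AlgebraicGeometry.HodgeTheory.WeilClassesDescendingTransfer
import Literature.AlgebraicGeometry.HodgeTheory.WeilSurfaceCMSquareAlgebraic
import Literature.AlgebraicGeometry.HodgeTheory.WeilClassesTensorPointAlgebraic
import HarnessLib

/-!
# Weil classes: the elliptic exchange (product step + CM-square descent, run backwards)

Family `hodge`, layer `Literature/AlgebraicGeometry/HodgeTheory`. Theorems-only companion of
`WeilClassesProductsOfFactors` (Schoen's product step, `weilClassesOf_prod_le_algebraicClasses`),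
`WeilClassesDescendingTransfer` (Schoen's descent along a Weil-type surface with partner,
`Schoen1998_weilClasses_algebraic_of_prod_surface_all_holds`), `WeilSurfaceCMSquareAlgebraic`
(the CM square `E₀ × E₀`, `Φ = ψ₀ × (-ψ₀)`, is a Weil-type surface WITH descent partner,
`exists_weilType_cmSquare_partner`) and `WeilClassesTensorPointAlgebraic` (algebraicity of the whole
Weil plane is an isogeny invariant, `weilClassesOf_le_algebraicClasses_of_isogenyPair`). No named
fact is introduced or discharged; everything is proved on the layer's real carriers.

## What is proved

Let `K = ℚ(√-d)`, `d ≥ 1`, act on complex abelian varieties through endomorphisms of square `-d`: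
`(Y, ψ)` of dimension `4`, `(Z, χ)` of dimension `3`, and a CM CURVE `(E₀, ψ₀)` of dimension `1`
(given as data). Write `E = (E₀, ψ₀)`, `Ē = (E₀, -ψ₀)`, `S = E × Ē = (E₀ × E₀, ψ₀ × (-ψ₀))` (the CM
square), `T = Y × Z × Z` with the diagonal structure `ψ × χ × χ` (an abelian TENFOLD), and call
`F_Y = Y × Ē × Ē` (a sixfold) and `F_Z = Z × E` (a fourfold) the ELLIPTIC COMPLETIONS of the factors.
**`weilClasses_ellipticExchange_four_three_three`**: if the Weil planes
`weilClassesOf F_Y (ψ × (-ψ₀) × (-ψ₀)) 3 d` and `weilClassesOf F_Z (χ × ψ₀) 2 d` consist of algebraic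
classes, then every rational class of Hodge type `(5,5)` in the Weil plane `weilClassesOf T (ψ × χ × χ) 5 d`
is algebraic. Proof, verbatim the printed ingredients composed:
(1) PRODUCT (Schoen 1998 §10, proof p. 333; `weilClassesOf_prod_le_algebraicClasses`, twice): the
Weil plane of `F_Y × (F_Z × F_Z)` (a `14`-fold, level `7`) is algebraic;
(2) REGROUP: the factor permutation `(T × S) × S ≅ F_Y × (F_Z × F_Z)` is an isomorphism of abelian
varieties intertwining the diagonal `K`-structures (`ellipticExchangeHom/Inv`, `…_comm`), hence
(`weilClassesOf_le_algebraicClasses_of_isogenyPair` with `m = 1`; an isomorphism is flat) the Weil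
plane of `(T × S) × S` is algebraic;
(3) DESCEND twice along the CM square `S` with its descent partner
(`exists_weilType_cmSquare_partner`, `Schoen1998_weilClasses_algebraic_of_prod_surface_all_holds` at
`n = 6` and `n = 5`).
In print the all-CM prototype is Deligne's construction of Weil-type sub-structures from sums of CM
types with constant total (LNM 900, §5 (c), "`A = ⊕ A_{Φᵢ}` … under the assumption that `Σᵢ Φᵢ` =
constant"), and the tensor identification `W_K(X) = ⊗_K W_K(Yᵢ^{mᵢ})` of Moonen–Zarhin (Math. Ann.
1998, p. 2); the lemma pads `T` by `(E × Ē)²` so that the factors regroup into BALANCED completions,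
for which — and only for which — the Weil plane can consist of algebraic classes. Nothing here uses
Hodge types: on unbalanced completions the hypotheses are simply never satisfied.

USE (summit side, not imported here): for `Y` of `K`-signature `(3,1)` and `Z` of signature `(1,2)`
(`χ` = the conjugate structure of a `(2,1)` threefold) the completions `F_Y`, `F_Z` are of split Weil
type `(3,3)`, `(2,2)` (a factor of odd `K`-rank realises every discriminant class by rescaling the
product polarisation; van Geemen LNM 1594 Lemma 5.2 (3), Schoen 1998 §10), so the hypotheses are
cases of the split sixfold slice (Koike 2004 for `ℚ(i)`, Schoen 1988/1998 for `ℚ(√-3)`, Markman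
arXiv:2502.03415 Thm. 1.5.1 in general) and of its descent to fourfolds.

## References

* [Schoen1998HodgeWeilAddendum] C. Schoen, Addendum to: Hodge classes on self-products of a variety
  with an automorphism, Compositio Math. 114 (1998) 329–336, §10 (Proposition and proof, pp. 332–333).
* [Deligne1982HodgeCycles] P. Deligne (notes by J. S. Milne), Hodge cycles on abelian varieties,
  LNM 900 (1982), §4 (4.8), §5 (c).
* [MoonenZarhin1998WeilClasses] B. Moonen, Yu. Zarhin, Weil classes on abelian varieties,
  J. reine angew. Math. 496 (1998), p. 2 (tensor identification) and Criterion (4.1).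
* [vanGeemen1994HodgeAV] B. van Geemen, An introduction to the Hodge conjecture for abelian
  varieties, LNM 1594 (1994), Lemma 5.2, 5.3.
* [Markman2025SurveySecant] E. Markman, arXiv:2509.23403, §11.5 Steps 1–2.
-/

noncomputable section

open CategoryTheory

namespace Literature.AlgebraicGeometry.HodgeTheory

open Literature.AlgebraicTopology.SingularHomology
open Literature.AlgebraicGeometry.Motives (IsSmoothProjective)
open Motives.AbelianVariety (prodLift prodLift_fst prodLift_snd prodLift_fst_assoc prodLift_snd_assoc
  prod_hom_ext)

section Shuffle

/-! ### The factor permutation `((A × (B₁ × B₂)) × (C₁ × C₂)) × (C₃ × C₄) ≅ (A × (C₂ × C₄)) × ((B₁ × C₁) × (B₂ × C₃))` -/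

variable (A B₁ B₂ C₁ C₂ C₃ C₄ : Motives.AbelianVariety ℂ)

/-- The factor permutation `(((a, (b₁, b₂)), (c₁, c₂)), (c₃, c₄)) ↦ ((a, (c₂, c₄)), ((b₁, c₁), (b₂, c₃)))`
(a homomorphism of abelian varieties, built from the projections). [folklore] -/
def ellipticExchangeHom :
    ((A.prod (B₁.prod B₂)).prod (C₁.prod C₂)).prod (C₃.prod C₄) ⟶
      (A.prod (C₂.prod C₄)).prod ((B₁.prod C₁).prod (B₂.prod C₃)) :=
  prodLift
    (prodLift
      (Motives.AbelianVariety.fst ((A.prod (B₁.prod B₂)).prod (C₁.prod C₂)) (C₃.prod C₄) ≫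
        Motives.AbelianVariety.fst (A.prod (B₁.prod B₂)) (C₁.prod C₂) ≫
          Motives.AbelianVariety.fst A (B₁.prod B₂))
      (prodLift
        (Motives.AbelianVariety.fst ((A.prod (B₁.prod B₂)).prod (C₁.prod C₂)) (C₃.prod C₄) ≫
          Motives.AbelianVariety.snd (A.prod (B₁.prod B₂)) (C₁.prod C₂) ≫
            Motives.AbelianVariety.snd C₁ C₂)
        (Motives.AbelianVariety.snd ((A.prod (B₁.prod B₂)).prod (C₁.prod C₂)) (C₃.prod C₄) ≫
          Motives.AbelianVariety.snd C₃ C₄)))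
    (prodLift
      (prodLift
        (Motives.AbelianVariety.fst ((A.prod (B₁.prod B₂)).prod (C₁.prod C₂)) (C₃.prod C₄) ≫
          Motives.AbelianVariety.fst (A.prod (B₁.prod B₂)) (C₁.prod C₂) ≫
            Motives.AbelianVariety.snd A (B₁.prod B₂) ≫ Motives.AbelianVariety.fst B₁ B₂)
        (Motives.AbelianVariety.fst ((A.prod (B₁.prod B₂)).prod (C₁.prod C₂)) (C₃.prod C₄) ≫
          Motives.AbelianVariety.snd (A.prod (B₁.prod B₂)) (C₁.prod C₂) ≫
            Motives.AbelianVariety.fst C₁ C₂))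
      (prodLift
        (Motives.AbelianVariety.fst ((A.prod (B₁.prod B₂)).prod (C₁.prod C₂)) (C₃.prod C₄) ≫
          Motives.AbelianVariety.fst (A.prod (B₁.prod B₂)) (C₁.prod C₂) ≫
            Motives.AbelianVariety.snd A (B₁.prod B₂) ≫ Motives.AbelianVariety.snd B₁ B₂)
        (Motives.AbelianVariety.snd ((A.prod (B₁.prod B₂)).prod (C₁.prod C₂)) (C₃.prod C₄) ≫
          Motives.AbelianVariety.fst C₃ C₄)))

/-- The inverse factor permutation `((a, (c₂, c₄)), ((b₁, c₁), (b₂, c₃))) ↦ (((a, (b₁, b₂)), (c₁, c₂)), (c₃, c₄))`.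
[folklore] -/
def ellipticExchangeInv :
    (A.prod (C₂.prod C₄)).prod ((B₁.prod C₁).prod (B₂.prod C₃)) ⟶
      ((A.prod (B₁.prod B₂)).prod (C₁.prod C₂)).prod (C₃.prod C₄) :=
  prodLift
    (prodLift
      (prodLift
        (Motives.AbelianVariety.fst (A.prod (C₂.prod C₄)) ((B₁.prod C₁).prod (B₂.prod C₃)) ≫
          Motives.AbelianVariety.fst A (C₂.prod C₄))
        (prodLift
          (Motives.AbelianVariety.snd (A.prod (C₂.prod C₄)) ((B₁.prod C₁).prod (B₂.prod C₃)) ≫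
            Motives.AbelianVariety.fst (B₁.prod C₁) (B₂.prod C₃) ≫ Motives.AbelianVariety.fst B₁ C₁)
          (Motives.AbelianVariety.snd (A.prod (C₂.prod C₄)) ((B₁.prod C₁).prod (B₂.prod C₃)) ≫
            Motives.AbelianVariety.snd (B₁.prod C₁) (B₂.prod C₃) ≫ Motives.AbelianVariety.fst B₂ C₃)))
      (prodLift
        (Motives.AbelianVariety.snd (A.prod (C₂.prod C₄)) ((B₁.prod C₁).prod (B₂.prod C₃)) ≫
          Motives.AbelianVariety.fst (B₁.prod C₁) (B₂.prod C₃) ≫ Motives.AbelianVariety.snd B₁ C₁)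
        (Motives.AbelianVariety.fst (A.prod (C₂.prod C₄)) ((B₁.prod C₁).prod (B₂.prod C₃)) ≫
          Motives.AbelianVariety.snd A (C₂.prod C₄) ≫ Motives.AbelianVariety.fst C₂ C₄)))
    (prodLift
      (Motives.AbelianVariety.snd (A.prod (C₂.prod C₄)) ((B₁.prod C₁).prod (B₂.prod C₃)) ≫
        Motives.AbelianVariety.snd (B₁.prod C₁) (B₂.prod C₃) ≫ Motives.AbelianVariety.snd B₂ C₃)
      (Motives.AbelianVariety.fst (A.prod (C₂.prod C₄)) ((B₁.prod C₁).prod (B₂.prod C₃)) ≫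
        Motives.AbelianVariety.snd A (C₂.prod C₄) ≫ Motives.AbelianVariety.snd C₂ C₄))

/-- `hom ≫ inv = 𝟙`. [folklore] -/
private theorem ellipticExchangeHom_comp_inv :
    ellipticExchangeHom A B₁ B₂ C₁ C₂ C₃ C₄ ≫ ellipticExchangeInv A B₁ B₂ C₁ C₂ C₃ C₄ = 𝟙 _ := by
  refine prod_hom_ext (prod_hom_ext (prod_hom_ext ?_ (prod_hom_ext ?_ ?_)) (prod_hom_ext ?_ ?_))
    (prod_hom_ext ?_ ?_) <;>
  simp only [ellipticExchangeHom, ellipticExchangeInv, Category.assoc, Category.id_comp,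
    prodLift_fst, prodLift_snd, prodLift_fst_assoc, prodLift_snd_assoc]

/-- `inv ≫ hom = 𝟙`. [folklore] -/
private theorem ellipticExchangeInv_comp_hom :
    ellipticExchangeInv A B₁ B₂ C₁ C₂ C₃ C₄ ≫ ellipticExchangeHom A B₁ B₂ C₁ C₂ C₃ C₄ = 𝟙 _ := by
  refine prod_hom_ext (prod_hom_ext ?_ (prod_hom_ext ?_ ?_))
    (prod_hom_ext (prod_hom_ext ?_ ?_) (prod_hom_ext ?_ ?_)) <;>
  simp only [ellipticExchangeHom, ellipticExchangeInv, Category.assoc, Category.id_comp,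
    prodLift_fst, prodLift_snd, prodLift_fst_assoc, prodLift_snd_assoc]

/-- The factor permutation is flat (it is an isomorphism of the underlying schemes). [folklore] -/
private theorem flat_ellipticExchangeHom :
    _root_.AlgebraicGeometry.Flat (ellipticExchangeHom A B₁ B₂ C₁ C₂ C₃ C₄).hom.hom.hom.left := by
  have h1 := congrArg (fun f : _ ⟶ ((A.prod (B₁.prod B₂)).prod (C₁.prod C₂)).prod (C₃.prod C₄) ↦
    f.hom.hom.hom.left) (ellipticExchangeHom_comp_inv A B₁ B₂ C₁ C₂ C₃ C₄)
  have h2 := congrArg (fun f : _ ⟶ (A.prod (C₂.prod C₄)).prod ((B₁.prod C₁).prod (B₂.prod C₃)) ↦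
    f.hom.hom.hom.left) (ellipticExchangeInv_comp_hom A B₁ B₂ C₁ C₂ C₃ C₄)
  haveI : IsIso (ellipticExchangeHom A B₁ B₂ C₁ C₂ C₃ C₄).hom.hom.hom.left :=
    ⟨⟨(ellipticExchangeInv A B₁ B₂ C₁ C₂ C₃ C₄).hom.hom.hom.left, h1, h2⟩⟩
  exact MorphismProperty.of_isIso @_root_.AlgebraicGeometry.Flat _

variable {A B₁ B₂ C₁ C₂ C₃ C₄}

/-- The factor permutation intertwines the diagonal endomorphisms: with `α` on `A`, `βᵢ` on `Bᵢ`,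
`γⱼ` on `Cⱼ`, `inv ≫ (α × (β₁ × β₂)) × (γ₁ × γ₂) × (γ₃ × γ₄) = (α × (γ₂ × γ₄)) × ((β₁ × γ₁) × (β₂ × γ₃)) ≫ inv`.
[folklore] -/
private theorem ellipticExchangeInv_comm (α : A ⟶ A) (β₁ : B₁ ⟶ B₁) (β₂ : B₂ ⟶ B₂) (γ₁ : C₁ ⟶ C₁)
    (γ₂ : C₂ ⟶ C₂) (γ₃ : C₃ ⟶ C₃) (γ₄ : C₄ ⟶ C₄) :
    ellipticExchangeInv A B₁ B₂ C₁ C₂ C₃ C₄ ≫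
        prodLift
          (Motives.AbelianVariety.fst ((A.prod (B₁.prod B₂)).prod (C₁.prod C₂)) (C₃.prod C₄) ≫
            prodLift
              (Motives.AbelianVariety.fst (A.prod (B₁.prod B₂)) (C₁.prod C₂) ≫
                prodLift (Motives.AbelianVariety.fst A (B₁.prod B₂) ≫ α)
                  (Motives.AbelianVariety.snd A (B₁.prod B₂) ≫
                    prodLift (Motives.AbelianVariety.fst B₁ B₂ ≫ β₁) (Motives.AbelianVariety.snd B₁ B₂ ≫ β₂)))
              (Motives.AbelianVariety.snd (A.prod (B₁.prod B₂)) (C₁.prod C₂) ≫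
                prodLift (Motives.AbelianVariety.fst C₁ C₂ ≫ γ₁) (Motives.AbelianVariety.snd C₁ C₂ ≫ γ₂)))
          (Motives.AbelianVariety.snd ((A.prod (B₁.prod B₂)).prod (C₁.prod C₂)) (C₃.prod C₄) ≫
            prodLift (Motives.AbelianVariety.fst C₃ C₄ ≫ γ₃) (Motives.AbelianVariety.snd C₃ C₄ ≫ γ₄)) =
      prodLift
          (Motives.AbelianVariety.fst (A.prod (C₂.prod C₄)) ((B₁.prod C₁).prod (B₂.prod C₃)) ≫
            prodLift (Motives.AbelianVariety.fst A (C₂.prod C₄) ≫ α)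
              (Motives.AbelianVariety.snd A (C₂.prod C₄) ≫
                prodLift (Motives.AbelianVariety.fst C₂ C₄ ≫ γ₂) (Motives.AbelianVariety.snd C₂ C₄ ≫ γ₄)))
          (Motives.AbelianVariety.snd (A.prod (C₂.prod C₄)) ((B₁.prod C₁).prod (B₂.prod C₃)) ≫
            prodLift
              (Motives.AbelianVariety.fst (B₁.prod C₁) (B₂.prod C₃) ≫
                prodLift (Motives.AbelianVariety.fst B₁ C₁ ≫ β₁) (Motives.AbelianVariety.snd B₁ C₁ ≫ γ₁))
              (Motives.AbelianVariety.snd (B₁.prod C₁) (B₂.prod C₃) ≫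
                prodLift (Motives.AbelianVariety.fst B₂ C₃ ≫ β₂) (Motives.AbelianVariety.snd B₂ C₃ ≫ γ₃))) ≫
        ellipticExchangeInv A B₁ B₂ C₁ C₂ C₃ C₄ := by
  refine prod_hom_ext (prod_hom_ext (prod_hom_ext ?_ (prod_hom_ext ?_ ?_)) (prod_hom_ext ?_ ?_))
    (prod_hom_ext ?_ ?_) <;>
  simp only [ellipticExchangeInv, Category.assoc, prodLift_fst, prodLift_snd, prodLift_fst_assoc,
    prodLift_snd_assoc]

end Shuffle

section EllipticExchange

/-! ### The elliptic exchange for the tenfold `Y × Z × Z` -/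

variable {Y Z E₀ : Motives.AbelianVariety ℂ} {d : ℕ} {ψ : Y ⟶ Y} {χ : Z ⟶ Z} {ψ₀ : E₀ ⟶ E₀}

/-- `(-ψ₀) ≫ (-ψ₀) = ψ₀ ≫ ψ₀`. [folklore] -/
private theorem neg_comp_neg_eq_neg_nsmul (hψ₀ : ψ₀ ≫ ψ₀ = -(d • 𝟙 E₀)) : (-ψ₀) ≫ (-ψ₀) = -(d • 𝟙 E₀) := by
  rw [Preadditive.neg_comp, Preadditive.comp_neg, neg_neg, hψ₀]

/-- **The elliptic exchange** (Schoen 1998 §10 run backwards along the CM square; Deligne LNM 900 §5 (c);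
Moonen–Zarhin 1998 p. 2). `K = ℚ(√-d)` acting by `ψ` on `Y` (`dim 4`), `χ` on `Z` (`dim 3`), `ψ₀` on the
curve `E₀`; `T = Y × (Z × Z)` with `ψ × (χ × χ)`; completions `F_Y = Y × (E₀ × E₀)` with
`ψ × ((-ψ₀) × (-ψ₀))` and `F_Z = Z × E₀` with `χ × ψ₀`. If the Weil planes of `F_Y` (level `3`) and of
`F_Z` (level `2`) consist of algebraic classes, then every rational `(5,5)`-class of the Weil plane of
`T` (level `5`) is algebraic. PROVENANCE: the statement is the COMPOSITION (this layer's) of the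
cited printed steps — Schoen's product step and his descent along a Weil-type surface (§10), applied
to Deligne's CM padding `E × Ē` (§5 (c)) — and is not itself a numbered result of the sources; each
citation tag below names exactly the step it formalises, and the proof is unconditional on the carriers.
[cite: Schoen1998HodgeWeilAddendum, §10 (Proposition and proof, pp. 332–333)]
[cite: Deligne1982HodgeCycles, §5 (c) and (4.8)] [cite: MoonenZarhin1998WeilClasses, p. 2] -/
theorem weilClasses_ellipticExchange_four_three_three (hd : 0 < d) (hY : Y.dim = 4) (hZ : Z.dim = 3)
    (hE : E₀.dim = 1) (hψ : ψ ≫ ψ = -(d • 𝟙 Y)) (hχ : χ ≫ χ = -(d • 𝟙 Z))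
    (hψ₀ : ψ₀ ≫ ψ₀ = -(d • 𝟙 E₀))
    (hFY : weilClassesOf (Y.prod (E₀.prod E₀))
        (prodLift (Motives.AbelianVariety.fst Y (E₀.prod E₀) ≫ ψ)
          (Motives.AbelianVariety.snd Y (E₀.prod E₀) ≫
            prodLift (Motives.AbelianVariety.fst E₀ E₀ ≫ (-ψ₀)) (Motives.AbelianVariety.snd E₀ E₀ ≫ (-ψ₀))))
        3 d ≤ algebraicClasses (Y.prod (E₀.prod E₀)).X 3)
    (hFZ : weilClassesOf (Z.prod E₀)
        (prodLift (Motives.AbelianVariety.fst Z E₀ ≫ χ) (Motives.AbelianVariety.snd Z E₀ ≫ ψ₀)) 2 d ≤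
      algebraicClasses (Z.prod E₀).X 2) :
    ∀ c : complexBetti (Y.prod (Z.prod Z)).X (2 * 5), IsRationalClass c →
      IsOfHodgeType (2 * 5) (Y.prod (Z.prod Z)).X (2 * 5) 5 5 c →
        c ∈ weilClassesOf (Y.prod (Z.prod Z))
          (prodLift (Motives.AbelianVariety.fst Y (Z.prod Z) ≫ ψ)
            (Motives.AbelianVariety.snd Y (Z.prod Z) ≫
              prodLift (Motives.AbelianVariety.fst Z Z ≫ χ) (Motives.AbelianVariety.snd Z Z ≫ χ))) 5 d →
        c ∈ algebraicClasses (Y.prod (Z.prod Z)).X 5 := by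
  -- the CM square `S = (E₀ × E₀, ψ₀ × (-ψ₀))` with its descent partner
  obtain ⟨hSd, hSsp, hΦ, hpartner⟩ := exists_weilType_cmSquare_partner hE hd hψ₀
  have hnψ₀ := neg_comp_neg_eq_neg_nsmul hψ₀
  -- squares of the diagonal endomorphisms
  have hχχ := prodLift_comp_self_eq_neg_nsmul hχ hχ
  have hφT := prodLift_comp_self_eq_neg_nsmul hψ hχχ
  have hφTS := prodLift_comp_self_eq_neg_nsmul hφT hΦ
  have hΦ' := prodLift_comp_self_eq_neg_nsmul hnψ₀ hnψ₀
  have hφFY := prodLift_comp_self_eq_neg_nsmul hψ hΦ'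
  have hφFZ := prodLift_comp_self_eq_neg_nsmul hχ hψ₀
  have hφFZFZ := prodLift_comp_self_eq_neg_nsmul hφFZ hφFZ
  have hφR := prodLift_comp_self_eq_neg_nsmul hφFY hφFZFZ
  -- dimensions
  have hTd : (Y.prod (Z.prod Z)).dim = 2 * 5 := by
    rw [Motives.AbelianVariety.dim_prod, Motives.AbelianVariety.dim_prod, hY, hZ]
  have hTSd : ((Y.prod (Z.prod Z)).prod (E₀.prod E₀)).dim = 2 * 6 := by
    rw [Motives.AbelianVariety.dim_prod, hTd, hSd]
  have hLd : (((Y.prod (Z.prod Z)).prod (E₀.prod E₀)).prod (E₀.prod E₀)).dim = 2 * 7 := by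
    rw [Motives.AbelianVariety.dim_prod, hTSd, hSd]
  have hFYd : (Y.prod (E₀.prod E₀)).dim = 2 * 3 := by
    rw [Motives.AbelianVariety.dim_prod, hY, hSd]
  have hFZd : (Z.prod E₀).dim = 2 * 2 := by
    rw [Motives.AbelianVariety.dim_prod, hZ, hE]
  have hFZFZd : ((Z.prod E₀).prod (Z.prod E₀)).dim = 2 * 4 := by
    rw [Motives.AbelianVariety.dim_prod, hFZd]
  have hRd : ((Y.prod (E₀.prod E₀)).prod ((Z.prod E₀).prod (Z.prod E₀))).dim = 2 * 7 := by
    rw [Motives.AbelianVariety.dim_prod, hFYd, hFZFZd]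
  -- (1) PRODUCT: the Weil plane of `F_Y × (F_Z × F_Z)` is algebraic
  have hWFZFZ := weilClassesOf_prod_le_algebraicClasses two_pos hd hFZd hFZd hφFZ hφFZ hFZ hFZ
  have hWR := weilClassesOf_prod_le_algebraicClasses three_pos hd hFYd hFZFZd hφFY hφFZFZ hFY hWFZFZ
  -- (2) REGROUP: `(T × S) × S ≅ F_Y × (F_Z × F_Z)` intertwining the structures; an iso is flat
  haveI := flat_ellipticExchangeHom Y Z Z E₀ E₀ E₀ E₀
  have hWL : weilClassesOf (((Y.prod (Z.prod Z)).prod (E₀.prod E₀)).prod (E₀.prod E₀))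
      (prodLift
        (Motives.AbelianVariety.fst ((Y.prod (Z.prod Z)).prod (E₀.prod E₀)) (E₀.prod E₀) ≫
          prodLift
            (Motives.AbelianVariety.fst (Y.prod (Z.prod Z)) (E₀.prod E₀) ≫
              prodLift (Motives.AbelianVariety.fst Y (Z.prod Z) ≫ ψ)
                (Motives.AbelianVariety.snd Y (Z.prod Z) ≫
                  prodLift (Motives.AbelianVariety.fst Z Z ≫ χ) (Motives.AbelianVariety.snd Z Z ≫ χ)))
            (Motives.AbelianVariety.snd (Y.prod (Z.prod Z)) (E₀.prod E₀) ≫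
              prodLift (Motives.AbelianVariety.fst E₀ E₀ ≫ ψ₀) (Motives.AbelianVariety.snd E₀ E₀ ≫ (-ψ₀))))
        (Motives.AbelianVariety.snd ((Y.prod (Z.prod Z)).prod (E₀.prod E₀)) (E₀.prod E₀) ≫
          prodLift (Motives.AbelianVariety.fst E₀ E₀ ≫ ψ₀) (Motives.AbelianVariety.snd E₀ E₀ ≫ (-ψ₀))))
      7 d ≤ algebraicClasses (((Y.prod (Z.prod Z)).prod (E₀.prod E₀)).prod (E₀.prod E₀)).X 7 :=
    weilClassesOf_le_algebraicClasses_of_isogenyPair (Motives.isSmoothProjective_of_dim_eq' hLd)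
      (Motives.isSmoothProjective_of_dim_eq' hRd) (ellipticExchangeHom Y Z Z E₀ E₀ E₀ E₀)
      (ellipticExchangeInv Y Z Z E₀ E₀ E₀ E₀) (ellipticExchangeInv_comm ψ χ χ ψ₀ (-ψ₀) ψ₀ (-ψ₀))
      one_pos (by rw [one_nsmul]; exact ellipticExchangeHom_comp_inv Y Z Z E₀ E₀ E₀ E₀) hWR
  -- (3) DESCEND twice along the CM square
  have h6 := Schoen1998_weilClasses_algebraic_of_prod_surface_all_holds 6 (by norm_num) d hd
    ((Y.prod (Z.prod Z)).prod (E₀.prod E₀)) _ (E₀.prod E₀) _ hTSd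
    (Motives.isSmoothProjective_of_dim_eq' hTSd) hφTS hSd hSsp hΦ hpartner
    (fun c _ _ hcW ↦ hWL hcW)
  exact Schoen1998_weilClasses_algebraic_of_prod_surface_all_holds 5 (by norm_num) d hd
    (Y.prod (Z.prod Z)) _ (E₀.prod E₀) _ hTd (Motives.isSmoothProjective_of_dim_eq' hTd) hφT hSd hSsp
    hΦ hpartner h6

end EllipticExchange

end Literature.AlgebraicGeometry.HodgeTheory

end
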